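/-
Copyright (c) 2026 the pub-hodgecm-mathlib formalisation cell (harness21).  Prover seat hodgecm-mathlib-R90-CS-p03 (g2), R90-TF section S8 «ContSpec-n½» (dealer R90-CS-plan (g3),
S8-R180 FLAG ④ «owner R90-CS-p03 after (a-10b): ONE file `K2E1ChiIntertwinedAmplitudeInvarianceU3`»): the three rows `hAgm hAgB hAgN` of the (R)′ ∕ (V) OF-RECORD bills about
`g ↦ Ag g (3∕2)` (measurability, `B(F)`- and `N(𝔸)`-invariance) TRANSFERRED from the same facts about `ψ_z = ((E_z)_B − φ·H^z)∕H^{2−z}`, which are (E)-letters.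
-/
import Mathlib.Analysis.Complex.Convex
import Mathlib.Analysis.Complex.CauchyIntegral
import Mathlib.Analysis.Analytic.Uniqueness
import Mathlib.MeasureTheory.Constructions.BorelSpace.Metrizable
import Mathlib.MeasureTheory.Function.SpecialFunctions.Basic
import Mathlib.Analysis.Complex.RemovableSingularity                                         -- ED. 2: `analyticAt_of_differentiable_on_punctured_nhds_of_continuousAt`
import Summits.HodgeConjecture.HodgeConjecture.Theorems.K2E1ConvexDiffCountableConnected     -- ED. 2: ★ `isPreconnected_convex_diff_of_countable`, `countable_of_codiscrete`; brings ★ `one_lt_rank_real_complex`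
import HarnessLib

/-!
# K2·E1 ∕ R90·S8 — `K2E1ChiIntertwinedAmplitudeInvarianceU3` (FLAG ④): INVARIANCE AND MEASURABILITY OF THE AMPLITUDE `g ↦ A_g(z)` ARE INHERITED FROM `ψ`
# `ψ_z(g) = A_g(z)·c_S(z)` on `{2 < Re z}` + `c_S ≠ 0` there + holomorphy of `A_g` on `{1 < Re}` ⟹ (`ψ_z ∘ T = ψ_z` on `{2<Re}` ⟹ `A_{Tg} = A_g` on `{1<Re}`); `A_g(3∕2) = lim_{z→3∕2} ψ_z(g)·A₁(z)∕q_c(z)` is measurable in `g`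

Cell `pub/hodgecm-mathlib`, crux h413 = `stmt-HodgeConjecture-24833`, route of record `HCCMUnconditional`; R90-TF section S8 «ContSpec-n½», the scalar road J-S8-SCAL of the (R)′ ∕ (V)
OF-RECORD files (K2E1-p12 `R90S8ResGMidBlockScalarRoadOfRecordU3`, K2E1-p15 `R90S8ResGMidBlockNeBotOfRecordU3`): their per-generator rows `Ag hAg hAg1 hM cS hq hψ2` (★ (a-7) p863512 ∕
★ (a-8) p863561 inputs) come with THREE MORE ROWS not in (V)'s bill (★ p863518 `ctPackage_of_scalarRoad`'s `hφtm hφtB hφtN` at `φt := Ag · ∕ A₁`): `hAgm : Measurable (fun g => Ag g (3∕2))`,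
`hAgB : ∀ b ∈ B(F), ∀ x, Ag (b*x) (3∕2) = Ag x (3∕2)`, `hAgN : ∀ u ∈ N(𝔸), ∀ g, Ag (u*g) (3∕2) = Ag g (3∕2)`.  THIS FILE pays them ABSTRACTLY (any type `G`, any self-map `T`),
from facts about `ψ` that the (E)-letters give (`ψ_z g := ((Ec z)_B g − φ g·H(g)^z)∕H(g)^{2−z}` is left-`N(𝔸)`- and `B(F)`-invariant because the constant term, the section and the
height are — ★ `borelHeight_unipotent_mul`, ★ `borelHeight_arithmeticBorel_mul`, automorphy; and `ψ_z` is measurable because the constant term is, (E4)).  THEOREMS ONLY (no `def`,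
no `instance`, no notation, no named-fact hypothesis, no `sorry`); lane `--supports stmt-HodgeConjecture-24833 --as helper` (count-neutral).  Closes no socket.

THE MATHEMATICS ([MoeglinWaldspurger1995] II.1.7, IV.1.11; [Langlands1976] §7).  (i) INVARIANCE: `F := A_{Tg} − A_g` is holomorphic on the half-plane `{1 < Re}` (convex, hence
preconnected) and `F·c_S = ψ_z(Tg) − ψ_z(g) = 0` on `{2 < Re}` where `c_S ≠ 0`, so `F = 0` on the non-empty open set `{2 < Re}` and, by the identity theorem, on `{1 < Re}` — in
particular at `3∕2`.  (ii) MEASURABILITY: by ★ (a-8) `eventually_factorisation_of_unfolded`, `ψ_z(g) = q_c(z)·A_g(z)∕A₁(z)` for all `g` and all `z` in a punctured neighbourhood of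
`3∕2`; where `q_c(z) ≠ 0` (near the simple pole, residue `ρ ≠ 0`) and `A₁(z) ≠ 0` (continuity, `A₁(3∕2) ≠ 0`) this reads `A_g(z) = ψ_z(g)·A₁(z)∕q_c(z)`, measurable in `g`; letting
`z → 3∕2` along the punctured neighbourhood filter (countably generated), `A_g(3∕2)` is a pointwise limit of measurable functions (Mathlib `measurable_of_tendsto_metrizable'`).
* §1 `eq_zero_on_halfPlane_of_mul_eq_zero` — the identity-theorem transfer `{2 < Re} → {1 < Re}`.
* §2 `amplitude_comp_eq` (any `T : G → G`), `amplitude_mul_left_eq_of_mem` (`∀ b ∈ S`), `amplitude_coe_mul_left_eq` (`∀ u : ι`, `c : ι → G`) — at every `z` with `1 < Re z` and AT `3∕2`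
  (`…_threeHalves`); `psi_comp_eq_of_parts` (the `ψ` of record is `T`-invariant when `E_z`, `φ`, `H` are).
* §3 `eventually_ne_zero_of_tendsto_sub_mul` (`ρ ≠ 0 ⟹ q_c ≠ 0` near `3∕2`), `measurable_psi_of_parts`, HEAD `measurable_amplitude_threeHalves`.
* §4 (ED. 2) `eventually_qc_ne_zero_of_letters` — the row `hqc0` DISCHARGED from the scalar road's own letters `q qc P hqcq hPcd hqa A hA hA32 cS hq` + `c_S ≠ 0` on `{2<Re}` + ★ F5's
  residue-limit `hρ` with ANY `ρ` (also `ρ = 0`): `(z − 3∕2)·q_c` has a removable singularity at `3∕2`, is analytic on the preconnected `{1<Re} ∖ (P ∖ {3∕2})` and non-zero at a point of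
  `{2<Re} ∖ P` (identity theorem for `A₁`, `A₁(3∕2) ≠ 0`), hence not eventually zero at `3∕2` (identity theorem again), so `q_c ≠ 0` on a punctured neighbourhood (isolated zeros) — NO
  `ρ ≠ 0` (central-value) row is needed; `measurable_amplitude_threeHalves_of_letters` = the HEAD with `hqc0` fed this way.
HONEST SCOPE: the ψ-level inputs (`hψT`, `hψm`, `c_S ≠ 0` on `{2<Re}`, `ρ ≠ 0`) are rows of the OF-RECORD files' existing letters, not discharged here.  HONEST LABEL: HC_CM is proved only
modulo the 7 printed citations (2 remaining named inputs: hLiu418 = `stmt-HodgeConjecture-24832`, h413 = `stmt-HodgeConjecture-24833`) until rung 0 closes; REL ≠ ★ ≠ BUILT; this file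
asserts no named fact and closes no socket; count-neutral; unconditional complex analysis ∕ measure theory.

## References
* [MoeglinWaldspurger1995] C. Mœglin, J.-L. Waldspurger, *Spectral Decomposition and Eisenstein Series* (1995): II.1.7, IV.1.11.
* [Langlands1976] R. P. Langlands, *On the Functional Equations Satisfied by Eisenstein Series*, LNM 544 (1976): §7.
* [Titchmarsh1939] E. C. Titchmarsh, *The Theory of Functions*, 2nd ed. (1939): §3.3 (identity theorem).
-/

set_option autoImplicit false
set_option linter.dupNamespace false -- the mandated namespace repeats `HodgeConjecture.HodgeConjecture`

noncomputable section

open MeasureTheory Filter Set Topology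
open scoped NNReal
open Summit.HodgeConjecture.HodgeConjecture.Cruxes.H413.K2E1ConvexDiffCountableConnected (isPreconnected_convex_diff_of_countable countable_of_codiscrete)
open Literature.Topology.Euclidean (one_lt_rank_real_complex)

namespace Summit.HodgeConjecture.HodgeConjecture.Cruxes.H413.K2E1ChiIntertwinedAmplitudeInvarianceU3

/-! ## §1 The identity-theorem transfer `{2 < Re} → {1 < Re}` -/

/-- `{1 < Re z}` is preconnected (a convex half-plane). [folklore] -/
theorem isPreconnected_one_lt_re : IsPreconnected {z : ℂ | 1 < z.re} := (convex_halfSpace_re_gt 1).isPreconnected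

/-- `3∕2 ∈ {1 < Re}`. [folklore] -/
theorem threeHalves_mem : ((3 : ℂ) / 2) ∈ {z : ℂ | 1 < z.re} := by
  show (1 : ℝ) < ((3 : ℂ) / 2).re
  norm_num

/-- **TRANSFER BY THE IDENTITY THEOREM**: if `F` is holomorphic on `{1 < Re}`, `F·c = 0` on `{2 < Re}` and `c ≠ 0` on `{2 < Re}`, then `F = 0` on `{1 < Re}` (`F` vanishes on the non-empty
open subset `{2 < Re}` of the preconnected open set `{1 < Re}`). [cite: Titchmarsh1939, §3.3] -/
theorem eq_zero_on_halfPlane_of_mul_eq_zero (F c : ℂ → ℂ) (hF : DifferentiableOn ℂ F {z : ℂ | 1 < z.re}) (hc : ∀ z : ℂ, 2 < z.re → c z ≠ 0)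
    (h0 : ∀ z : ℂ, 2 < z.re → F z * c z = 0) {z : ℂ} (hz : 1 < z.re) : F z = 0 := by
  have han : AnalyticOnNhd ℂ F {z : ℂ | 1 < z.re} := hF.analyticOnNhd (isOpen_lt continuous_const Complex.continuous_re)
  have h3 : (3 : ℂ) ∈ {z : ℂ | 1 < z.re} := by
    show (1 : ℝ) < (3 : ℂ).re
    norm_num
  have hev : F =ᶠ[𝓝 (3 : ℂ)] 0 := by
    have hopen2 : IsOpen {z : ℂ | 2 < z.re} := isOpen_lt continuous_const Complex.continuous_re
    filter_upwards [hopen2.mem_nhds (show (2 : ℝ) < (3 : ℂ).re by norm_num)] with w hw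
    have hw' : 2 < w.re := hw
    exact (mul_eq_zero.1 (h0 w hw')).resolve_right (hc w hw')
  exact han.eqOn_zero_of_preconnected_of_eventuallyEq_zero isPreconnected_one_lt_re h3 hev hz

/-! ## §2 Invariance of the amplitude under a self-map `T` of `G`, inherited from `ψ` -/

section Invariance

variable {G : Type*} (ψ : ℂ → G → ℂ) (Ag : G → ℂ → ℂ) (cS : ℂ → ℂ)
  (hAg : ∀ g, DifferentiableOn ℂ (Ag g) {z : ℂ | 1 < z.re}) (hψ2 : ∀ z : ℂ, 2 < z.re → ∀ g, ψ z g = Ag g z * cS z) (hcS : ∀ z : ℂ, 2 < z.re → cS z ≠ 0)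

include hAg hψ2 hcS in
/-- **`A_{Tg} = A_g` ON `{1 < Re}` WHEN `ψ_z(Tg) = ψ_z(g)` ON `{2 < Re}`** (any self-map `T : G → G`; letters `hAg hψ2` of ★ (a-8) and `c_S ≠ 0` on `{2 < Re}`): `(A_{Tg} − A_g)·c_S = 0` on
`{2 < Re}`, identity theorem (§1). [cite: MoeglinWaldspurger1995, II.1.7] [cite: Titchmarsh1939, §3.3] -/
theorem amplitude_comp_eq (T : G → G) (hψT : ∀ z : ℂ, 2 < z.re → ∀ g, ψ z (T g) = ψ z g) (g : G) {z : ℂ} (hz : 1 < z.re) : Ag (T g) z = Ag g z := by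
  have h := eq_zero_on_halfPlane_of_mul_eq_zero (fun w => Ag (T g) w - Ag g w) cS ((hAg (T g)).sub (hAg g)) hcS (fun w hw => by
    show (Ag (T g) w - Ag g w) * cS w = 0
    rw [sub_mul, ← hψ2 w hw (T g), ← hψ2 w hw g, hψT w hw g, sub_self]) hz
  exact sub_eq_zero.1 h

include hAg hψ2 hcS in
/-- The same AT `z = 3∕2`: `Ag (T g) (3∕2) = Ag g (3∕2)`. [cite: MoeglinWaldspurger1995, II.1.7, IV.1.11] -/
theorem amplitude_comp_eq_threeHalves (T : G → G) (hψT : ∀ z : ℂ, 2 < z.re → ∀ g, ψ z (T g) = ψ z g) (g : G) : Ag (T g) ((3 : ℂ) / 2) = Ag g ((3 : ℂ) / 2) :=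
  amplitude_comp_eq ψ Ag cS hAg hψ2 hcS T hψT g threeHalves_mem

include hAg hψ2 hcS in
/-- **ROW `hAgB`-SHAPE** (`∀ b ∈ S, ∀ x, Ag (b*x) (3∕2) = Ag x (3∕2)` for a subset `S` of a multiplicative `G`, e.g. `S = B(F)`), from `∀ b ∈ S, ψ_z(b·x) = ψ_z(x)` on `{2 < Re}`.
[cite: MoeglinWaldspurger1995, II.1.7] -/
theorem amplitude_mul_left_eq_of_mem [Mul G] (S : Set G) (hψS : ∀ z : ℂ, 2 < z.re → ∀ b ∈ S, ∀ x : G, ψ z (b * x) = ψ z x) :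
    ∀ b ∈ S, ∀ x : G, Ag (b * x) ((3 : ℂ) / 2) = Ag x ((3 : ℂ) / 2) :=
  fun b hb x => amplitude_comp_eq_threeHalves ψ Ag cS hAg hψ2 hcS (fun x => b * x) (fun z hz x => hψS z hz b hb x) x

include hAg hψ2 hcS in
/-- **ROW `hAgN`-SHAPE** (`∀ (u : ι) g, Ag (c u * g) (3∕2) = Ag g (3∕2)` for a family `c : ι → G`, e.g. the coercion `↥N(𝔸) → G(𝔸)`), from `∀ u g, ψ_z(c u·g) = ψ_z(g)` on `{2 < Re}`.
[cite: MoeglinWaldspurger1995, II.1.7] -/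
theorem amplitude_coe_mul_left_eq [Mul G] {ι : Type*} (c : ι → G) (hψc : ∀ z : ℂ, 2 < z.re → ∀ (u : ι) (g : G), ψ z (c u * g) = ψ z g) :
    ∀ (u : ι) (g : G), Ag (c u * g) ((3 : ℂ) / 2) = Ag g ((3 : ℂ) / 2) :=
  fun u g => amplitude_comp_eq_threeHalves ψ Ag cS hAg hψ2 hcS (fun g => c u * g) (fun z hz g => hψc z hz u g) g

end Invariance

/-- **THE `ψ` OF RECORD IS `T`-INVARIANT WHEN ITS PARTS ARE**: `ψ_z(g) := (E_z(g) − φ(g)·H(g)^z)∕H(g)^{2−z}` (★ p863518's shape, `E_z = (Ec z)_B`, `H = borelHeight`) satisfies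
`ψ_z(Tg) = ψ_z(g)` as soon as `E_z(Tg) = E_z(g)`, `φ(Tg) = φ(g)`, `H(Tg) = H(g)`. [folklore] -/
theorem psi_comp_eq_of_parts {G : Type*} (E : ℂ → G → ℂ) (φ : G → ℂ) (H : G → ℝ≥0) (T : G → G) (z : ℂ)
    (hE : ∀ g, E z (T g) = E z g) (hφ : ∀ g, φ (T g) = φ g) (hH : ∀ g, H (T g) = H g) (g : G) :
    (E z (T g) - φ (T g) * (((H (T g) : ℝ≥0) : ℝ) : ℂ) ^ z) / (((H (T g) : ℝ≥0) : ℝ) : ℂ) ^ (2 - z) =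
      (E z g - φ g * (((H g : ℝ≥0) : ℝ) : ℂ) ^ z) / (((H g : ℝ≥0) : ℝ) : ℂ) ^ (2 - z) := by
  rw [hE, hφ, hH]

/-! ## §3 Measurability of `g ↦ A_g(3∕2)`, inherited from `ψ` -/

/-- **`q_c ≠ 0` NEAR `3∕2`** from a non-zero residue: `(z − 3∕2)·q_c(z) → ρ ≠ 0` along `𝓝[≠] 3∕2` ⟹ `q_c(z) ≠ 0` eventually there. [folklore] -/
theorem eventually_ne_zero_of_tendsto_sub_mul (qc : ℂ → ℂ) {ρ : ℂ} (hρ : Tendsto (fun z : ℂ => (z - (3 : ℂ) / 2) * qc z) (𝓝[≠] ((3 : ℂ) / 2)) (𝓝 ρ)) (hρ0 : ρ ≠ 0) :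
    ∀ᶠ z in 𝓝[≠] ((3 : ℂ) / 2), qc z ≠ 0 := by
  filter_upwards [hρ.eventually_ne hρ0] with z hz
  exact fun h => hz (by rw [h, mul_zero])

/-- **THE `ψ` OF RECORD IS MEASURABLE WHEN ITS PARTS ARE** (`E_z`, `φ`, `H` measurable in `g`; complex powers of the real cast are measurable, Mathlib `Complex.hasMeasurablePow`). [folklore] -/
theorem measurable_psi_of_parts {G : Type*} [MeasurableSpace G] (E : ℂ → G → ℂ) (φ : G → ℂ) (H : G → ℝ≥0) (z : ℂ)
    (hE : Measurable (E z)) (hφ : Measurable φ) (hH : Measurable H) :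
    Measurable fun g : G => (E z g - φ g * (((H g : ℝ≥0) : ℝ) : ℂ) ^ z) / (((H g : ℝ≥0) : ℝ) : ℂ) ^ (2 - z) := by
  have hHc : Measurable fun g : G => (((H g : ℝ≥0) : ℝ) : ℂ) := Complex.measurable_ofReal.comp (measurable_coe_nnreal_real.comp hH)
  exact (hE.sub (hφ.mul (hHc.pow_const z))).div (hHc.pow_const _)

/-- **HEAD (FLAG ④, row `hAgm`).  `g ↦ A_g(3∕2)` IS MEASURABLE** whenever every `ψ_z` is measurable in `g`, the factorisation `ψ_z(g) = q_c(z)·A_g(z)∕A₁(z)` holds for all `g` on a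
punctured neighbourhood of `3∕2` (★ (a-8) `eventually_factorisation_of_unfolded`'s conclusion, verbatim), `q_c ≠ 0` near `3∕2` (`eventually_ne_zero_of_tendsto_sub_mul`), `A₁` is
holomorphic on `{1 < Re}` with `A₁(3∕2) ≠ 0` (★ F5's `hA hA32`), and each `A_g` is holomorphic on `{1 < Re}` (`hAg`): then `A_g(3∕2) = lim_{z → 3∕2, z ≠ 3∕2} ψ_z(g)·(A₁(z)∕q_c(z))`
pointwise in `g`, a limit of measurable functions along a countably generated filter. [cite: MoeglinWaldspurger1995, II.1.7, IV.1.11] [cite: Langlands1976, §7] -/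
theorem measurable_amplitude_threeHalves {G : Type*} [MeasurableSpace G] (ψ : ℂ → G → ℂ) (Ag : G → ℂ → ℂ) (qc A₁ : ℂ → ℂ)
    (hψm : ∀ z : ℂ, Measurable (ψ z)) (hfac : ∀ᶠ z in 𝓝[≠] ((3 : ℂ) / 2), ∀ g, ψ z g = qc z * (Ag g z / A₁ z))
    (hqc0 : ∀ᶠ z in 𝓝[≠] ((3 : ℂ) / 2), qc z ≠ 0) (hA : DifferentiableOn ℂ A₁ {z : ℂ | 1 < z.re}) (hA32 : A₁ (3 / 2) ≠ 0)
    (hAg : ∀ g, DifferentiableOn ℂ (Ag g) {z : ℂ | 1 < z.re}) :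
    Measurable fun g : G => Ag g ((3 : ℂ) / 2) := by
  -- `A₁ ≠ 0` near `3∕2`
  have hA1 : ∀ᶠ z in 𝓝[≠] ((3 : ℂ) / 2), A₁ z ≠ 0 :=
    mem_nhdsWithin_of_mem_nhds ((hA.continuousOn.continuousAt ((isOpen_lt continuous_const Complex.continuous_re).mem_nhds threeHalves_mem)).eventually_ne hA32)
  -- the measurable approximants `g ↦ ψ_z(g)·(A₁ z ∕ q_c z)`
  have hf : ∀ z : ℂ, Measurable fun g : G => ψ z g * (A₁ z / qc z) := fun z => (hψm z).mul_const _
  refine measurable_of_tendsto_metrizable' (𝓝[≠] ((3 : ℂ) / 2)) hf (tendsto_pi_nhds.2 fun g => ?_)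
  -- pointwise: eventually `ψ_z(g)·(A₁ z ∕ q_c z) = A_g(z)`, and `A_g(z) → A_g(3∕2)`
  have hcont : Tendsto (fun z => Ag g z) (𝓝[≠] ((3 : ℂ) / 2)) (𝓝 (Ag g ((3 : ℂ) / 2))) :=
    (((hAg g).continuousOn.continuousAt ((isOpen_lt continuous_const Complex.continuous_re).mem_nhds threeHalves_mem)).tendsto).mono_left nhdsWithin_le_nhds
  refine hcont.congr' ?_
  filter_upwards [hfac, hqc0, hA1] with z hz hq hA1z
  rw [hz g]
  field_simp

/-! ## §4 (ED. 2) The row `hqc0` from the scalar road's letters — no `ρ ≠ 0` needed -/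

/-- **A POINT OF `{2 < Re} ∖ P` WHERE `A₁ ≠ 0`**: `A₁` holomorphic on `{1 < Re}` with `A₁(3∕2) ≠ 0` cannot vanish on the whole of `{2 < Re} ∖ P` (`P` co-discrete, so that set has interior;
identity theorem on the convex half-plane). [cite: Titchmarsh1939, §3.3] -/
theorem exists_two_lt_re_not_mem_ne_zero (P : Set ℂ) (hPcd : ∀ z₀ : ℂ, ∀ᶠ s in 𝓝[≠] z₀, s ∉ P) (A₁ : ℂ → ℂ) (hA : DifferentiableOn ℂ A₁ {z : ℂ | 1 < z.re})
    (hA32 : A₁ (3 / 2) ≠ 0) : ∃ z₁ : ℂ, 2 < z₁.re ∧ z₁ ∉ P ∧ A₁ z₁ ≠ 0 := by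
  have hopen : IsOpen {z : ℂ | 1 < z.re} := isOpen_lt continuous_const Complex.continuous_re
  have hopen2 : IsOpen {z : ℂ | 2 < z.re} := isOpen_lt continuous_const Complex.continuous_re
  -- a point `z₂` of the open set `{2 < Re}` outside the countable `P`, with a whole neighbourhood outside `P`
  obtain ⟨z₂, hz₂P, hz₂⟩ : ∃ z₂, z₂ ∈ Pᶜ ∧ z₂ ∈ {z : ℂ | 2 < z.re} :=
    ((countable_of_codiscrete hPcd).dense_compl ℝ).exists_mem_open hopen2 ⟨3, by show (2 : ℝ) < (3 : ℂ).re; norm_num⟩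
  have hz₂' : 2 < z₂.re := hz₂
  have hnhd : ∀ᶠ s in 𝓝 z₂, s ∉ P ∧ 2 < s.re := by
    have h1 : ∀ᶠ s in 𝓝 z₂, s ∉ P := by
      rw [← nhdsNE_sup_pure z₂, eventually_sup]
      exact ⟨hPcd z₂, hz₂P⟩
    exact h1.and (hopen2.mem_nhds hz₂')
  by_contra h
  push Not at h
  -- then `A₁ = 0` near `z₂`, hence on `{1 < Re}` by the identity theorem, contradicting `A₁(3∕2) ≠ 0`
  have hev : A₁ =ᶠ[𝓝 z₂] 0 := by
    filter_upwards [hnhd] with s hs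
    exact h s hs.2 hs.1
  have hEq := (hA.analyticOnNhd hopen).eqOn_zero_of_preconnected_of_eventuallyEq_zero isPreconnected_one_lt_re (show (1 : ℝ) < z₂.re by linarith) hev
  exact hA32 (hEq (show (1 : ℝ) < ((3 : ℂ) / 2).re by norm_num))

/-- **ROW `hqc0` FROM THE LETTERS (ED. 2).**  With the scalar road's letters of ★ (a-8) — `hqcq : q_c = q` on `{2<Re}`, `hPcd` (`P` co-discrete), `hqa` (`q_c` analytic off `P`), `hA hA32`,
`hq : q = A₁·c_S` on `{2<Re}` — plus `c_S ≠ 0` on `{2<Re}` and ★ F5's residue-limit `(z − 3∕2)·q_c(z) → ρ` along `𝓝[≠] 3∕2` for ANY `ρ` (`ρ = 0` allowed):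
`q_c(z) ≠ 0` on a punctured neighbourhood of `3∕2`.  Proof: `G := update ((z − 3∕2)·q_c) (3∕2) ρ` is analytic at `3∕2` (removable singularity, Mathlib
`analyticAt_of_differentiable_on_punctured_nhds_of_continuousAt`) and on `V = {1<Re} ∖ (P ∖ {3∕2})` (preconnected, ★ `isPreconnected_convex_diff_of_countable`), non-zero at a point of
`{2<Re} ∖ P` (`exists_two_lt_re_not_mem_ne_zero`), so not eventually zero at `3∕2` (identity theorem) — isolated zeros. [cite: Titchmarsh1939, §3.3] [cite: MoeglinWaldspurger1995, IV.1.11] -/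
theorem eventually_qc_ne_zero_of_letters (q qc : ℂ → ℂ) (P : Set ℂ) (hqcq : ∀ z : ℂ, 2 < z.re → qc z = q z) (hPcd : ∀ z₀ : ℂ, ∀ᶠ s in 𝓝[≠] z₀, s ∉ P)
    (hqa : ∀ z : ℂ, z ∉ P → AnalyticAt ℂ qc z) (A₁ : ℂ → ℂ) (hA : DifferentiableOn ℂ A₁ {z : ℂ | 1 < z.re}) (hA32 : A₁ (3 / 2) ≠ 0)
    (cS : ℂ → ℂ) (hq : ∀ z : ℂ, 2 < z.re → q z = A₁ z * cS z) (hcS : ∀ z : ℂ, 2 < z.re → cS z ≠ 0)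
    {ρ : ℂ} (hρ : Tendsto (fun z : ℂ => (z - (3 : ℂ) / 2) * qc z) (𝓝[≠] ((3 : ℂ) / 2)) (𝓝 ρ)) :
    ∀ᶠ z in 𝓝[≠] ((3 : ℂ) / 2), qc z ≠ 0 := by
  have hopen : IsOpen {z : ℂ | 1 < z.re} := isOpen_lt continuous_const Complex.continuous_re
  -- the regularised function `G`
  set G : ℂ → ℂ := Function.update (fun z => (z - (3 : ℂ) / 2) * qc z) ((3 : ℂ) / 2) ρ with hG
  have hGoff : ∀ z : ℂ, z ≠ (3 : ℂ) / 2 → G z = (z - (3 : ℂ) / 2) * qc z := fun z hz => by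
    rw [hG, Function.update_of_ne hz]
  -- `g = (z − 3∕2)·q_c` is analytic off `P`
  have hgan : ∀ z : ℂ, z ∉ P → AnalyticAt ℂ (fun z => (z - (3 : ℂ) / 2) * qc z) z := fun z hz =>
    (analyticAt_id.sub analyticAt_const).mul (hqa z hz)
  -- `G` is analytic at every point off `P ∖ {3∕2}`
  have hGan_off : ∀ z : ℂ, z ∉ P → z ≠ (3 : ℂ) / 2 → AnalyticAt ℂ G z := fun z hzP hz => by
    refine (hgan z hzP).congr ?_
    filter_upwards [isOpen_ne.mem_nhds hz] with w hw
    exact (hGoff w hw).symm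
  have hGan32 : AnalyticAt ℂ G ((3 : ℂ) / 2) := by
    refine Complex.analyticAt_of_differentiable_on_punctured_nhds_of_continuousAt ?_ ?_
    · filter_upwards [hPcd ((3 : ℂ) / 2), self_mem_nhdsWithin] with w hwP hw
      exact (hGan_off w hwP hw).differentiableAt
    · rw [hG, continuousAt_update_same]
      exact hρ
  -- the domain `V = {1 < Re} ∖ (P ∖ {3∕2})`, preconnected
  have hCc : (P \ {(3 : ℂ) / 2}).Countable := (countable_of_codiscrete hPcd).mono Set.sdiff_subset
  have hVpc : IsPreconnected ({z : ℂ | 1 < z.re} \ (P \ {(3 : ℂ) / 2})) :=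
    isPreconnected_convex_diff_of_countable one_lt_rank_real_complex (convex_halfSpace_re_gt 1) hopen hCc
  have hGanV : AnalyticOnNhd ℂ G ({z : ℂ | 1 < z.re} \ (P \ {(3 : ℂ) / 2})) := by
    intro z hz
    rcases eq_or_ne z ((3 : ℂ) / 2) with rfl | hne
    · exact hGan32
    · exact hGan_off z (fun hzP => hz.2 ⟨hzP, hne⟩) hne
  have h32V : ((3 : ℂ) / 2) ∈ {z : ℂ | 1 < z.re} \ (P \ {(3 : ℂ) / 2}) := ⟨threeHalves_mem, fun h => h.2 rfl⟩
  -- a point of `V` where `G ≠ 0`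
  obtain ⟨z₁, hz₁, hz₁P, hz₁A⟩ := exists_two_lt_re_not_mem_ne_zero P hPcd A₁ hA hA32
  have hz₁ne : z₁ ≠ (3 : ℂ) / 2 := by
    intro h
    rw [h] at hz₁
    norm_num at hz₁
  have hGz₁ : G z₁ ≠ 0 := by
    rw [hGoff z₁ hz₁ne, hqcq z₁ hz₁, hq z₁ hz₁]
    exact mul_ne_zero (sub_ne_zero.2 hz₁ne) (mul_ne_zero hz₁A (hcS z₁ hz₁))
  have hz₁V : z₁ ∈ {z : ℂ | 1 < z.re} \ (P \ {(3 : ℂ) / 2}) := ⟨show (1 : ℝ) < z₁.re by linarith, fun h => hz₁P h.1⟩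
  -- `G` is not eventually zero at `3∕2`, hence eventually non-zero on the punctured neighbourhood
  rcases hGan32.eventually_eq_zero_or_eventually_ne_zero with h0 | hne
  · exact absurd (hGanV.eqOn_zero_of_preconnected_of_eventuallyEq_zero hVpc h32V h0 hz₁V) hGz₁
  · filter_upwards [hne, self_mem_nhdsWithin] with z hz hz32
    rw [hGoff z hz32] at hz
    exact (mul_ne_zero_iff.1 hz).2

/-- **HEAD (ED. 2): `g ↦ A_g(3∕2)` IS MEASURABLE, ALL ROWS FED FROM THE LETTERS** — `measurable_amplitude_threeHalves` with `hqc0 := eventually_qc_ne_zero_of_letters …` (no `ρ ≠ 0`).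
[cite: MoeglinWaldspurger1995, II.1.7, IV.1.11] [cite: Langlands1976, §7] -/
theorem measurable_amplitude_threeHalves_of_letters {G : Type*} [MeasurableSpace G] (ψ : ℂ → G → ℂ) (Ag : G → ℂ → ℂ)
    (q qc : ℂ → ℂ) (P : Set ℂ) (hqcq : ∀ z : ℂ, 2 < z.re → qc z = q z) (hPcd : ∀ z₀ : ℂ, ∀ᶠ s in 𝓝[≠] z₀, s ∉ P)
    (hqa : ∀ z : ℂ, z ∉ P → AnalyticAt ℂ qc z) (A₁ : ℂ → ℂ) (hA : DifferentiableOn ℂ A₁ {z : ℂ | 1 < z.re}) (hA32 : A₁ (3 / 2) ≠ 0)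
    (cS : ℂ → ℂ) (hq : ∀ z : ℂ, 2 < z.re → q z = A₁ z * cS z) (hcS : ∀ z : ℂ, 2 < z.re → cS z ≠ 0)
    {ρ : ℂ} (hρ : Tendsto (fun z : ℂ => (z - (3 : ℂ) / 2) * qc z) (𝓝[≠] ((3 : ℂ) / 2)) (𝓝 ρ))
    (hAg : ∀ g, DifferentiableOn ℂ (Ag g) {z : ℂ | 1 < z.re}) (hψm : ∀ z : ℂ, Measurable (ψ z))
    (hfac : ∀ᶠ z in 𝓝[≠] ((3 : ℂ) / 2), ∀ g, ψ z g = qc z * (Ag g z / A₁ z)) :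
    Measurable fun g : G => Ag g ((3 : ℂ) / 2) :=
  measurable_amplitude_threeHalves ψ Ag qc A₁ hψm hfac (eventually_qc_ne_zero_of_letters q qc P hqcq hPcd hqa A₁ hA hA32 cS hq hcS hρ) hA hA32 hAg

end Summit.HodgeConjecture.HodgeConjecture.Cruxes.H413.K2E1ChiIntertwinedAmplitudeInvarianceU3

end
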